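import Mathlib
import Summits.ValiantsHypothesis.ValiantsHypothesis.Theorems.BarrierLeverPartitionMinorsHitByVPHiddenStatesGradedColex

/-!
# Route BarrierLever — item `PartitionMinorsHitByVP` (stmt-ValiantsHypothesis-19717), line `hidden-states`:
# ONE PIECE AGAINST A DOWN-SET — THE BASE POINT IS IRRELEVANT (`det M_b = det M_0` exactly)

Helper file (`--supports stmt-ValiantsHypothesis-19717`; cell valiant-natproofs, rung V4, 𝒟-side door (c), registered line
`Cruxes/PartitionMinorsHitByVP/Lines/hidden_states.lean` v8; prover seat val-np-p6 gen 14). Definition-free; closes NO item.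

THE POINT. For a ONE-piece design `cols : Fin r → Finset (Fin K)` with table `t : Fin K → Fin h → ℂ` and base point `b : Fin h → ℂ`, the
hidden-point matrix against an injective row family `u` whose range is a LOWER SET satisfies
`M_b[i,k] = ∏_{a ∈ u i} (b a + s_k a) = Σ_{A ⊆ u i} b^{u i ∖ A} s_k^A = (Z_b · M_0)[i,k]` (`s_k = Σ_{q ∈ cols k} t q`), where
`Z_b[i,i'] = [u i' ⊆ u i] · b^{u i ∖ u i'}` runs over the rows only BECAUSE every subset of a row is a row. `Z_b` is block-unitriangular for
the cardinality of the rows, so `det M_b = det M_0` identically in `b` and `t` (`det_base_eq`). Consequences: in every one-piece question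
against down-sets (Conjecture GC½, HALF-BALL, the ball-diagonal eliminations) the base point may be taken `0` — or anything convenient —
without loss (`exists_table_iff_exists_table_zero`); dually (Artinian form, memo g14 §8(i)) `exp(β)` is a unit of `ℂ[∂]/(∂², ∂^A : A ∉ U)`.
For JOINS the relative base points of the pieces DO matter; nothing is claimed there.

* `sum_rows_subset_eq_sum_powerset` — re-indexing a sum over the rows contained in `u i` as a sum over `(u i).powerset`.
* **`det_base_eq`** — `det M_b = det M_0`.
* `exists_table_iff_exists_table_zero` — the `∃`-table form used by the GC½ hypothesis (`tx none` may be frozen to `0`).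

WHAT THIS IS NOT: a statement about joins of several pieces; nothing on crux 14610 or VP ≠ VNP.
-/

set_option linter.dupNamespace false

namespace Summit.ValiantsHypothesis.ValiantsHypothesis.Theorems.BarrierLever.HiddenStates

open Finset Matrix

noncomputable section

namespace BallDiag

/-- Re-indexing: for an injective row family with lower-set range, summing `g (u i')` over the rows `u i' ⊆ u i` is summing `g` over the
power set of `u i`. -/
theorem sum_rows_subset_eq_sum_powerset {h r : ℕ} {β : Type*} [AddCommMonoid β] (u : Fin r → Finset (Fin h))
    (hu : Function.Injective u) (hlow : IsLowerSet (Set.range u)) (i : Fin r) (g : Finset (Fin h) → β) :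
    ∑ i' ∈ Finset.univ.filter (fun i' => u i' ⊆ u i), g (u i') = ∑ A ∈ (u i).powerset, g A := by
  classical
  refine Finset.sum_bij (fun i' _ => u i') ?_ ?_ ?_ ?_
  · intro i' hi'
    exact Finset.mem_powerset.mpr (Finset.mem_filter.mp hi').2
  · intro i' _ j' _ hij
    exact hu hij
  · intro A hA
    obtain ⟨i', hi'⟩ := hlow (Finset.mem_powerset.mp hA) ⟨i, rfl⟩
    exact ⟨i', Finset.mem_filter.mpr ⟨Finset.mem_univ _, hi' ▸ Finset.mem_powerset.mp hA⟩, hi'⟩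
  · intro i' _
    rfl

/-- **THE BASE POINT IS IRRELEVANT (one piece, lower row family).** With `s k a := Σ_{q ∈ cols k} t q a`,
`det [∏_{a ∈ u i} (b a + s k a)] = det [∏_{a ∈ u i} s k a]`, identically. -/
theorem det_base_eq {h K r : ℕ} (u : Fin r → Finset (Fin h)) (hu : Function.Injective u) (hlow : IsLowerSet (Set.range u))
    (cols : Fin r → Finset (Fin K)) (t : Fin K → Fin h → ℂ) (b : Fin h → ℂ) :
    (Matrix.of fun i k : Fin r => ∏ a ∈ u i, (b a + ∑ q ∈ cols k, t q a)).det
      = (Matrix.of fun i k : Fin r => ∏ a ∈ u i, ∑ q ∈ cols k, t q a).det := by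
  classical
  set s : Fin r → Fin h → ℂ := fun k a => ∑ q ∈ cols k, t q a with hs
  set Z : Matrix (Fin r) (Fin r) ℂ := Matrix.of fun i i' => if u i' ⊆ u i then ∏ a ∈ u i \ u i', b a else 0 with hZ
  set M0 : Matrix (Fin r) (Fin r) ℂ := Matrix.of fun i k : Fin r => ∏ a ∈ u i, s k a with hM0
  -- the factorisation `M_b = Z · M_0`
  have hfac : (Matrix.of fun i k : Fin r => ∏ a ∈ u i, (b a + ∑ q ∈ cols k, t q a)) = Z * M0 := by
    ext i k
    rw [Matrix.mul_apply, Matrix.of_apply]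
    have h1 : ∏ a ∈ u i, (b a + ∑ q ∈ cols k, t q a) = ∑ A ∈ (u i).powerset, (∏ a ∈ u i \ A, b a) * ∏ a ∈ A, s k a := by
      rw [show (fun a => b a + ∑ q ∈ cols k, t q a) = fun a => s k a + b a from funext fun a => add_comm _ _]
      rw [Finset.prod_add]
      exact Finset.sum_congr rfl fun A _ => mul_comm _ _
    rw [h1]
    have h2 : ∑ j, Z i j * M0 j k = ∑ j ∈ Finset.univ.filter (fun i' => u i' ⊆ u i), (∏ a ∈ u i \ u j, b a) * ∏ a ∈ u j, s k a := by
      rw [Finset.sum_filter]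
      refine Finset.sum_congr rfl fun j _ => ?_
      simp only [hZ, hM0, Matrix.of_apply]
      split_ifs with hj
      · rfl
      · rw [zero_mul]
    rw [h2, sum_rows_subset_eq_sum_powerset u hu hlow i (fun A => (∏ a ∈ u i \ A, b a) * ∏ a ∈ A, s k a)]
  -- `Z` is block-unitriangular for the row cardinality
  have hZtri : Z.BlockTriangular (fun i => OrderDual.toDual (u i).card) := by
    intro i j hij
    have hlt : (u i).card < (u j).card := by
      have := hij; rwa [OrderDual.toDual_lt_toDual] at this
    simp only [hZ, Matrix.of_apply]
    rw [if_neg]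
    intro hsub
    exact absurd (Finset.card_le_card hsub) (by omega)
  have hZdet : Z.det = 1 := by
    rw [hZtri.det]
    refine Finset.prod_eq_one fun a _ => ?_
    have hblock : Z.toSquareBlock (fun i => OrderDual.toDual (u i).card) a = 1 := by
      ext ⟨i, hi⟩ ⟨j, hj⟩
      simp only [Matrix.toSquareBlock_def, hZ, Matrix.of_apply, Matrix.one_apply, Subtype.mk.injEq]
      by_cases hij : i = j
      · subst hij; simp
      · have hne : ¬ u j ⊆ u i := by
          intro hsub
          have hcard : (u j).card = (u i).card := by
            have h1 := congrArg OrderDual.ofDual hi; have h2 := congrArg OrderDual.ofDual hj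
            simp only [OrderDual.ofDual_toDual] at h1 h2
            rw [h1, h2]
          exact hij (hu (Finset.eq_of_subset_of_card_le hsub hcard.ge).symm)
        rw [if_neg hne, if_neg hij]
    rw [hblock, Matrix.det_one]
  rw [hfac, Matrix.det_mul, hZdet, one_mul]

/-- **`∃`-table form.** A one-piece design serves a lower row family with SOME table iff it does so with a table whose base point is `0`
(the shape of the GC½ hypothesis of `universalJoinWideLower_upperHalf_of_gc`, p636831, with `tx none` frozen). -/
theorem exists_table_iff_exists_table_zero {h K r : ℕ} (u : Fin r → Finset (Fin h)) (hu : Function.Injective u)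
    (hlow : IsLowerSet (Set.range u)) (cols : Fin r → Finset (Fin K)) :
    (∃ tx : Option (Fin K) → Fin h → ℂ,
        (Matrix.of fun i k : Fin r => ∏ a ∈ u i, (tx none a + ∑ q ∈ cols k, tx (some q) a)).det ≠ 0) ↔
      ∃ t : Fin K → Fin h → ℂ, (Matrix.of fun i k : Fin r => ∏ a ∈ u i, ∑ q ∈ cols k, t q a).det ≠ 0 := by
  constructor
  · rintro ⟨tx, htx⟩
    refine ⟨fun q => tx (some q), ?_⟩
    rwa [det_base_eq u hu hlow cols (fun q => tx (some q)) (tx none)] at htx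
  · rintro ⟨t, ht⟩
    refine ⟨fun o => Option.elim o (fun _ => 0) t, ?_⟩
    have := det_base_eq u hu hlow cols t (fun _ => 0)
    simp only [Option.elim]
    rw [this]
    exact ht

end BallDiag

end

end Summit.ValiantsHypothesis.ValiantsHypothesis.Theorems.BarrierLever.HiddenStates
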